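import Literature.IUT.HodgeTheaters.ThetaPMEllHodgeTheatersF
import Literature.IUT.HodgeTheaters.ThetaPMEllNFHodgeTheatersToy
import Literature.IUT.HodgeTheaters.FPrimeStripsRigidity
import Literature.IUT.HodgeTheaters.FKitCoreBridgeWitness
import Literature.IUT.HodgeTheaters.PMBaseBridgePropsProofs2
import Literature.IUT.HodgeTheaters.PMBaseBridgePropsProofs3
import HarnessLib

/-!
# [IUTchI] Def 6.11 (ii) / Cor 6.12 (i) — NON-VACUITY of the `ℱ`-level isomorphisms of Θ^{ell}-bridges
# `FKit.ThetaEllBridge.IsoF` (row «NV-L5/FKit.ThetaEllBridge.IsoF»)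

Mochizuki, *Inter-universal Teichmüller theory I*, kurims manuscript (May 2020), Def 6.11 (ii) p. 173: "an
isomorphism of Θ^{ell}-bridges … is a pair of poly-isomorphisms `†𝔉_T ⥲ ‡𝔉_{T'}`; `†𝒟^{⊚±} ⥲ ‡𝒟^{⊚±}` that
determines a morphism between the associated `𝒟-Θ^{ell}`-bridges"; Cor 6.12 (i) p. 173 (the map to
isomorphisms of the associated `𝒟-Θ^{ell}`-bridges is bijective, from Cor 5.3 (ii)); Prop 6.6 (ii) p. 165
(any two `𝒟-Θ^{ell}`-bridges are isomorphic).  PROOF-ONLY companion (no `def`, no `instance`, no `structure`)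
of `ThetaPMEllHodgeTheatersF.lean` (abc-iut-L5-t4: the record `PMBaseKit.FKit.ThetaEllBridge.IsoF` = the
`𝒟`-level isomorphism `toD` + `ℱ`-level capsule poly-isomorphisms `capsPoly` lifting its constituents).
abc-iut-w5-d197's INHABITATION CENSUS L5 v1 lists `FKit.ThetaEllBridge.IsoF` with ZERO producers; this file
records, kernel-checked:

* `ThetaEllBridge.IsoF.nonempty_iff` — the EXACT criterion, hypothesis-free: two Θ^{ell}-bridges admit an
  `ℱ`-level isomorphism iff some isomorphism of the associated `𝒟-Θ^{ell}`-bridges has all its capsule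
  constituents in the image of `𝔉 ↦ 𝔇` on isomorphisms (Rmk 5.2.1 (i), `FStrip.assocDMap`) — the lift is the
  full preimage `liftPoly` (Rmk 5.3.1); injectivity of `𝔉 ↦ 𝔇` (the other half of Cor 5.3 (ii)) is NOT needed
  for existence;
* `ThetaEllBridge.nonempty_iso` — the `𝒟`-level input is ALWAYS available: Prop 6.6 (ii), first clause,
  DISCHARGED by abc-iut-L5 (`DThetaEllBridge.isoTorsor_nonempty`, `PMBaseBridgePropsProofs2.lean`);
* `ThetaEllBridge.IsoF.nonempty_of_assocDMap_surjective` / `…_of_isomFtoDBijective` — hence over ANY `ℱ`-kit in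
  which `𝔉 ↦ 𝔇` is surjective on isomorphisms (in particular under Cor 5.3 (ii) `FKit.IsomFtoDBijective`, BY
  NAME) EVERY pair of Θ^{ell}-bridges is `ℱ`-isomorphic (with Cor 6.12 (i) this is the whole content: `IsoF B₁ B₂ ≃
  Iso B₁ B₂`, nonempty);
* `ThetaEllBridge.IsoF.nonempty_ofBase` — UNCONDITIONAL over abc-iut-L5-t3's `FKit.ofBase K' M'` (the `ℱ`-kit
  "ℱ-data := isomorphs of the 𝒟-data" over ANY base kit `K'`, for which Cor 5.3 (ii) is PROVED,
  `isomFtoDBijective_ofBase`) [model-relative];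
* `ThetaEllBridge.IsoF.nonempty_toy` / `exists_toy` — on a CLOSED TERM: the Θ^{ell}-bridge of the toy
  Θ^{±ell}-Hodge theater `FKit.ThetaPMEllHT.toy l hl` (abc-iut-L5, `ThetaPMEllNFHodgeTheatersToy.lean`) over
  `FKit.toy l hl` (`𝕍 = Unit`, base functor the identity, `isomFtoDBijective_toy`), any prime `l ≠ 2` [toy];
* the same three lines for Θ^{±ell}-Hodge theaters (`ThetaPMEllHT.IsoF`, Def 6.11 (iii)) and, through
  `IsoF.pmIsoF`, Θ^±-bridges arising from Θ^{±ell}-Hodge theaters (`ThetaPMBridge.IsoF`, Def 6.11 (i)).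

HONEST LABEL: model-relative (`ofBase`) + toy (closed term); the genuine printed objects (tempered Frobenioids over
the real initial Θ-data) are abc-iut-L5's D13 instance programme, not this file.  Nothing of [IUTchI] is asserted;
a witness is consistency evidence only ("type inhabited"). [claim: Mochizuki2012, status: disputed]
-/

namespace Literature.IUT.HodgeTheaters

open CategoryTheory

namespace PMBaseKit

universe u

namespace FKit

variable {l : ℕ} {K : PMBaseKit.{u} l} {M : K.MultKit} {FK : K.FKit M}

/-- **IUTchI:Rmk5.3.1** (kurims pp.145–146) If a poly-isomorphism `Φ` of associated `𝒟`-prime-strips consists of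
liftable isomorphisms, its lift `liftPoly Φ` (the full preimage under `𝔉 ↦ 𝔇`) has associated poly-isomorphism
exactly `Φ` — surjectivity onto `Φ` is all that is used (no injectivity). [claim: Mochizuki2012, status: disputed] -/
theorem image_assocDMap_liftPoly_of_subset_range {F₁ F₂ : FK.FStrip} (Φ : Set (F₁.assocD.Iso F₂.assocD))
    (hΦ : Φ ⊆ Set.range (FStrip.assocDMap (F₁ := F₁) (F₂ := F₂))) :
    FStrip.assocDMap '' liftPoly Φ = Φ :=
  Set.image_preimage_eq_of_subset hΦ

namespace ThetaEllBridge

/-- **IUTchI:Prop6.6(ii)** (kurims p.165), first clause, at the `ℱ`-level records: any two Θ^{ell}-bridges have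
isomorphic associated `𝒟-Θ^{ell}`-bridges — abc-iut-L5's DISCHARGED `DThetaEllBridge.isoTorsor_nonempty` read
through `ThetaEllBridge.Iso B₁ B₂ := DThetaEllBridge.Iso B₁.dBridge B₂.dBridge`. [claim: Mochizuki2012, status: disputed] -/
theorem nonempty_iso (B₁ B₂ : FK.ThetaEllBridge) : Nonempty (Iso B₁ B₂) :=
  DThetaEllBridge.isoTorsor_nonempty B₁.dBridge B₂.dBridge

/-- **IUTchI:Def6.11(ii)** (kurims p.173) EXACT CRITERION for the `ℱ`-level isomorphism record: `IsoF B₁ B₂` is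
inhabited iff some isomorphism `d` of the associated `𝒟-Θ^{ell}`-bridges has every capsule constituent
`d.capsPoly t` inside the image of `𝔉 ↦ 𝔇` on isomorphisms of `ℱ`-prime-strips (then `liftPoly (d.capsPoly t)`
"determines" `d`). Hypothesis-free. [claim: Mochizuki2012, status: disputed] -/
theorem IsoF.nonempty_iff (B₁ B₂ : FK.ThetaEllBridge) :
    Nonempty (IsoF B₁ B₂) ↔
      ∃ d : Iso B₁ B₂, ∀ t, d.capsPoly t ⊆
        Set.range (FStrip.assocDMap (F₁ := B₁.capsule t) (F₂ := B₂.capsule (d.indexEquiv t))) := by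
  constructor
  · rintro ⟨f⟩
    refine ⟨f.toD, fun t => ?_⟩
    rw [← f.capsPoly_lifts t]
    exact Set.image_subset_range _ _
  · rintro ⟨d, hd⟩
    exact ⟨⟨d, fun t => liftPoly (d.capsPoly t), fun t => image_assocDMap_liftPoly_of_subset_range _ (hd t)⟩⟩

/-- **IUTchI:Cor6.12(i)** (kurims p.173), existence half: if `𝔉 ↦ 𝔇` is SURJECTIVE on isomorphisms of
`ℱ`-prime-strips (the surjectivity half of Cor 5.3 (ii)), every isomorphism of associated `𝒟-Θ^{ell}`-bridges
lifts, so — Prop 6.6 (ii) supplying the `𝒟`-level isomorphism — EVERY two Θ^{ell}-bridges of the kit are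
`ℱ`-isomorphic. [claim: Mochizuki2012, status: disputed] -/
theorem IsoF.nonempty_of_assocDMap_surjective
    (h : ∀ F₁ F₂ : FK.FStrip, Function.Surjective (FStrip.assocDMap (FK := FK) (F₁ := F₁) (F₂ := F₂)))
    (B₁ B₂ : FK.ThetaEllBridge) : Nonempty (IsoF B₁ B₂) :=
  (IsoF.nonempty_iff B₁ B₂).2
    ⟨(nonempty_iso B₁ B₂).some, fun t φ _ => h (B₁.capsule t) (B₂.capsule _) φ⟩

/-- **IUTchI:Cor6.12(i)** (kurims p.173) Under Cor 5.3 (ii) BY NAME (`FKit.IsomFtoDBijective`), every two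
Θ^{ell}-bridges of the kit are `ℱ`-isomorphic (abc-iut-L5-t4's `isoFToDBijective_of_isomFtoDBijective` gives the
full bijection `IsoF B₁ B₂ → Iso B₁ B₂`; this is its non-vacuity reading). [claim: Mochizuki2012, status: disputed] -/
theorem IsoF.nonempty_of_isomFtoDBijective (h : FK.IsomFtoDBijective) (B₁ B₂ : FK.ThetaEllBridge) :
    Nonempty (IsoF B₁ B₂) :=
  IsoF.nonempty_of_assocDMap_surjective (fun F₁ F₂ => (h F₁ F₂).2) B₁ B₂

/-- **IUTchI:Cor6.12(i)** (kurims p.173) Under Cor 5.3 (ii) the `ℱ`-level and `𝒟`-level isomorphism types of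
two Θ^{ell}-bridges are in bijection (abc-iut-L5-t4), so the `ℱ`-level record is inhabited EXACTLY when the
`𝒟`-level one is — and the latter always is (Prop 6.6 (ii)). [claim: Mochizuki2012, status: disputed] -/
theorem IsoF.nonempty_iff_of_isomFtoDBijective (h : FK.IsomFtoDBijective) (B₁ B₂ : FK.ThetaEllBridge) :
    Nonempty (IsoF B₁ B₂) ↔ Nonempty (Iso B₁ B₂) :=
  ⟨fun ⟨f⟩ => ⟨f.toD⟩, fun _ => IsoF.nonempty_of_isomFtoDBijective h B₁ B₂⟩

/-- **IUTchI:Def6.11(ii)** (kurims p.173) MODEL-RELATIVE WITNESS, UNCONDITIONAL: over abc-iut-L5-t3's `ℱ`-kit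
`FKit.ofBase K' M'` ("ℱ-data := isomorphs of the 𝒟-data", ANY base kit `K'`; Cor 5.3 (ii) PROVED there,
`isomFtoDBijective_ofBase`) every two Θ^{ell}-bridges carry an `ℱ`-level isomorphism.
[claim: Mochizuki2012, status: disputed] -/
theorem IsoF.nonempty_ofBase (K' : PMBaseKit.{u} l) (M' : K'.MultKit) (B₁ B₂ : (FKit.ofBase K' M').ThetaEllBridge) :
    Nonempty (IsoF B₁ B₂) :=
  IsoF.nonempty_of_isomFtoDBijective (isomFtoDBijective_ofBase K' M') B₁ B₂

/-- **IUTchI:Def6.11(ii)** (kurims p.173) TOY WITNESS over the toy kits (prime `l ≠ 2`): every two Θ^{ell}-bridges of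
the toy `ℱ`-kit `FKit.toy l hl` (base functor the identity, `isomFtoDBijective_toy`) are `ℱ`-isomorphic.
[claim: Mochizuki2012, status: disputed] -/
theorem IsoF.nonempty_over_toy (l : ℕ) [Fact l.Prime] (hl : l ≠ 2) (B₁ B₂ : (FKit.toy l hl).ThetaEllBridge) :
    Nonempty (IsoF B₁ B₂) :=
  IsoF.nonempty_of_isomFtoDBijective (isomFtoDBijective_toy l hl) B₁ B₂

/-- **IUTchI:Def6.11(ii)** (kurims p.173) CLOSED-TERM TOY WITNESS: the Θ^{ell}-bridge of abc-iut-L5's toy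
Θ^{±ell}-Hodge theater `FKit.ThetaPMEllHT.toy l hl` (index set `𝔽_l`, all constituents the model `ℱ`-prime-strip,
`𝒟-Θ^{ell}`-bridge poly-morphisms those of Example 6.3 (i)) has an `ℱ`-level automorphism record — the type
`FKit.ThetaEllBridge.IsoF` is inhabited on explicit data. [claim: Mochizuki2012, status: disputed] -/
theorem IsoF.nonempty_toy (l : ℕ) [Fact l.Prime] (hl : l ≠ 2) :
    Nonempty (IsoF (ThetaPMEllHT.toy l hl).ellBridge (ThetaPMEllHT.toy l hl).ellBridge) :=
  IsoF.nonempty_over_toy l hl _ _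

/-- **IUTchI:Def6.11(ii)** (kurims p.173) The closed-term witness in existential form: some `ℱ`-kit (the toy one at
`l = 3`) carries a Θ^{ell}-bridge with an inhabited `ℱ`-level isomorphism record. [claim: Mochizuki2012, status: disputed] -/
theorem IsoF.exists_toy :
    ∃ (l : ℕ) (_ : Fact l.Prime) (hl : l ≠ 2) (B : (FKit.toy l hl).ThetaEllBridge), Nonempty (IsoF B B) :=
  ⟨3, ⟨Nat.prime_three⟩, by decide, (@ThetaPMEllHT.toy 3 ⟨Nat.prime_three⟩ (by decide)).ellBridge,
    @IsoF.nonempty_toy 3 ⟨Nat.prime_three⟩ (by decide)⟩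

end ThetaEllBridge

/-! ### The same for Θ^{±ell}-Hodge theaters (Def 6.11 (iii)) and their Θ^±-bridges (Def 6.11 (i)) -/

namespace ThetaPMEllHT

/-- **IUTchI:Prop6.6(iii)** (kurims p.165), first clause, at the `ℱ`-level records: any two Θ^{±ell}-Hodge
theaters have isomorphic associated `𝒟-Θ^{±ell}`-Hodge theaters (abc-iut-L5's DISCHARGED
`DThetaPMEllHT.isoTorsor_nonempty`). [claim: Mochizuki2012, status: disputed] -/
theorem nonempty_iso (H₁ H₂ : FK.ThetaPMEllHT) : Nonempty (Iso H₁ H₂) :=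
  DThetaPMEllHT.isoTorsor_nonempty H₁.dHT H₂.dHT

/-- **IUTchI:Def6.11(iii)** (kurims p.173) EXACT CRITERION: `ThetaPMEllHT.IsoF H₁ H₂` is inhabited iff some
isomorphism of the associated `𝒟-Θ^{±ell}`-Hodge theaters has its capsule constituents and its `†𝔇_≻ ⥲ ‡𝔇_≻`
component inside the image of `𝔉 ↦ 𝔇` on isomorphisms. Hypothesis-free. [claim: Mochizuki2012, status: disputed] -/
theorem IsoF.nonempty_iff (H₁ H₂ : FK.ThetaPMEllHT) :
    Nonempty (IsoF H₁ H₂) ↔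
      ∃ d : Iso H₁ H₂,
        (∀ t, d.pmIso.capsPoly t ⊆
          Set.range (FStrip.assocDMap (F₁ := H₁.capsule t) (F₂ := H₂.capsule (d.pmIso.indexEquiv t)))) ∧
        d.pmIso.codPoly ⊆ Set.range (FStrip.assocDMap (F₁ := H₁.codomain) (F₂ := H₂.codomain)) := by
  constructor
  · rintro ⟨f⟩
    refine ⟨f.toD, fun t => ?_, ?_⟩
    · rw [← f.capsPoly_lifts t]
      exact Set.image_subset_range _ _
    · rw [← f.codPoly_lifts]
      exact Set.image_subset_range _ _
  · rintro ⟨d, hd, hd'⟩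
    exact ⟨⟨d, fun t => liftPoly (d.pmIso.capsPoly t), liftPoly d.pmIso.codPoly,
      fun t => image_assocDMap_liftPoly_of_subset_range _ (hd t),
      image_assocDMap_liftPoly_of_subset_range _ hd'⟩⟩

/-- **IUTchI:Cor6.12(i)** (kurims p.173) Under Cor 5.3 (ii) BY NAME every two Θ^{±ell}-Hodge theaters of the kit
carry an `ℱ`-level isomorphism record. [claim: Mochizuki2012, status: disputed] -/
theorem IsoF.nonempty_of_isomFtoDBijective (h : FK.IsomFtoDBijective) (H₁ H₂ : FK.ThetaPMEllHT) :
    Nonempty (IsoF H₁ H₂) :=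
  (IsoF.nonempty_iff H₁ H₂).2
    ⟨(nonempty_iso H₁ H₂).some, fun t φ _ => (h (H₁.capsule t) (H₂.capsule _)).2 φ,
      fun φ _ => (h H₁.codomain H₂.codomain).2 φ⟩

/-- **IUTchI:Def6.11(iii)** (kurims p.173) MODEL-RELATIVE WITNESS, UNCONDITIONAL over `FKit.ofBase K' M'`.
[claim: Mochizuki2012, status: disputed] -/
theorem IsoF.nonempty_ofBase (K' : PMBaseKit.{u} l) (M' : K'.MultKit) (H₁ H₂ : (FKit.ofBase K' M').ThetaPMEllHT) :
    Nonempty (IsoF H₁ H₂) :=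
  IsoF.nonempty_of_isomFtoDBijective (isomFtoDBijective_ofBase K' M') H₁ H₂

/-- **IUTchI:Def6.11(iii)** (kurims p.173) CLOSED-TERM TOY WITNESS at the toy Θ^{±ell}-Hodge theater
`FKit.ThetaPMEllHT.toy l hl`. [claim: Mochizuki2012, status: disputed] -/
theorem IsoF.nonempty_toy (l : ℕ) [Fact l.Prime] (hl : l ≠ 2) :
    Nonempty (IsoF (ThetaPMEllHT.toy l hl) (ThetaPMEllHT.toy l hl)) :=
  IsoF.nonempty_of_isomFtoDBijective (isomFtoDBijective_toy l hl) _ _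

end ThetaPMEllHT

namespace ThetaPMBridge

/-- **IUTchI:Def6.11(i)** (kurims p.172) Under Cor 5.3 (ii) BY NAME, the Θ^±-bridges of any two Θ^{±ell}-Hodge
theaters of the kit carry an `ℱ`-level isomorphism record (the Θ^±-component `IsoF.pmIsoF` of a Θ^{±ell}-Hodge
theater isomorphism). [claim: Mochizuki2012, status: disputed] -/
theorem IsoF.nonempty_pmBridge_of_isomFtoDBijective (h : FK.IsomFtoDBijective) (H₁ H₂ : FK.ThetaPMEllHT) :
    Nonempty (IsoF H₁.pmBridge H₂.pmBridge) :=
  (ThetaPMEllHT.IsoF.nonempty_of_isomFtoDBijective h H₁ H₂).map ThetaPMEllHT.IsoF.pmIsoF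

/-- **IUTchI:Def6.11(i)** (kurims p.172) CLOSED-TERM TOY WITNESS: the Θ^±-bridge of the toy Θ^{±ell}-Hodge theater
has an `ℱ`-level automorphism record. [claim: Mochizuki2012, status: disputed] -/
theorem IsoF.nonempty_toy (l : ℕ) [Fact l.Prime] (hl : l ≠ 2) :
    Nonempty (IsoF (ThetaPMEllHT.toy l hl).pmBridge (ThetaPMEllHT.toy l hl).pmBridge) :=
  IsoF.nonempty_pmBridge_of_isomFtoDBijective (isomFtoDBijective_toy l hl) _ _

end ThetaPMBridge

end FKit

end PMBaseKit

end Literature.IUT.HodgeTheaters
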